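import Mathlib.NumberTheory.MulChar.Duality
import Mathlib.RingTheory.RootsOfUnity.AlgebraicallyClosed
import Mathlib.Analysis.Complex.Polynomial.Basic
import Mathlib.NumberTheory.Zsqrtd.GaussianInt
import HarnessLib

/-!
# Friedlander–Iwaniec, *The polynomial `X² + Y⁴` captures its primes*, §16: detecting `Δ(z₁, z₂) ≡ 0 (mod 4d)` with the characters of `(ℤ[i]/4dℤ[i])ˣ` ((16.3), (16.11)–(16.13), (16.42); (17.9)–(17.11))

Family `parity`, statement parity.S17 (`setOf_prime_sq_add_pow_four_infinite`). Source:
J. Friedlander, H. Iwaniec, Ann. of Math. (2) 148 (1998), 945–1040 [FriedlanderIwaniecAnnals1998],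
§16 "Estimation of `U(β)`", (16.1)–(16.4) and (16.11)–(16.13), (16.42), and §17, (17.9)–(17.11)
(arXiv math/9811185 pp. 58–60, 65, 67–68).

The main term `T(β)` of Proposition 10.2 ((10.13)) is a sum over pairs `(z₁, z₂)` with
`Δ(z₁, z₂) = Im z̄₁ z₂ ≡ 0 (mod 4d)` weighted by the real character `((z₂/z₁)/d)` of the rational
class `z₂/z₁ (mod 4d)`. Both the small moduli (`U(β)`, §16) and the large moduli (`W(β)`, §17,
after flipping) are treated by the same device: "First note that the condition
`Δ(z₁, z₂) ≡ 0 (mod 4d)` is equivalent to (16.3) `z₁ ≡ ω z₂ (mod 4d)` for some rational residue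
class `ω (mod 4d)`. Thus we can write (16.4)
`U_d(β) = ∑_{ω (mod 4d)} (ω/d) ∑∑_{z₁ ≡ ω z₂ (mod 4d)} …` … Now we detect the congruence (16.3)
by multiplicative characters of the group `(ℤ[i]/4dℤ[i])^*` getting (16.11)
`∑_ω (ω/d) ∑∑_{z₁ ≡ ω z₂} β_{z₁} β̄_{z₂} (z₁ z̄₂/|z₁ z₂|)^k = Φ(d)⁻¹ ∑_χ 𝒥(χ) |S_χ^k(β)|²` where
`Φ(d)` is the order of the group … and where (16.13) `𝒥(χ) = ∑_{ω (mod 4d)} χ(ω) (ω/d)`";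
"(16.42) `Φ(d)⁻¹ ∑_χ |𝒥(χ)|² = φ(d)`"; and in §17: "Since the condition `Δ(z₁, z₂) ≡ 0 (mod 4bd)`
is equivalent to `z₁ ≡ ω z₂ (mod 4bd)` for some rational `ω (mod 4bd)` we have (17.9) … We detect
the congruence `z₁ ≡ ω z₂ (mod 4bd)` by characters of `(ℤ[i]/4bdℤ[i])^*` getting (17.10)".

This file PROVES that device once, for a general modulus `q` (`= 4d`, `4bd`), a general
`q`-periodic weight `F` on the rational classes (`= (·/d)`) and general coefficients (the
`β_z (z/|z|)^k`, `β'_z (z/|z|)^k` of (16.10), (17.12) restricted to any finite support whose norms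
are prime to `q` — in the source `(z, Π) = 1` with `P > 4d`). No analysis, no named facts.

## Contents

* Characters of a finite commutative ring `M` (here `M = ℤ[i]/qℤ[i]`), values in `ℂ`:
  `card_mulChar_eq_card_units`, `norm_mulChar_apply_units`, `inv_mulChar_apply_units`
  (`χ(u)⁻¹ = conj χ(u)`), orthogonality over the characters `sum_mulChar_apply`,
  `sum_mulChar_inv_mul_apply`, the indicator `indicator_eq_sum_mulChar`
  (`[x = ωy] = #Mˣ⁻¹ ∑_χ χ(x)⁻¹ χ(ω) χ(y)`), the **bilinear detection identity**
  `sum_indicator_mul_eq_sum_mulChar`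
  (`∑_i j(i) ∑∑_{g a = e_i g b} c₁(a)c₂(b) = #Mˣ⁻¹ ∑_χ (∑_i j(i)χ(e_i)) (∑ c₁ χ⁻¹)(∑ c₂ χ)`) and
  **Parseval** `sum_norm_sq_charSum_eq` (`#Mˣ⁻¹ ∑_χ |∑_i j(i)χ(e_i)|² = ∑_i |j(i)|²` for distinct
  units `e_i`) — after Mathlib's `DirichletCharacter.sum_char_inv_mul_char_eq` and the tree's
  `CubicSieve.sum_mulChar_inv_mul_eq` (Heath-Brown's (9.1), for `𝓞_K/(q)`), here for any `M`.
* `GaussQuot q = ℤ[i] ⧸ (q)`, `toQuot q`, finiteness (`exists_fin_toQuot_eq`), `natCast_dvd_iff`;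
  **units**: `isUnit_toQuot_of_coprime` (`(N z, q) = 1 ⇒ z ∈ (ℤ[i]/q)ˣ`, as `z z̄ = N z`),
  `isUnit_toQuot_natCast_of_coprime`, `not_isUnit_toQuot_natCast`, `injOn_toQuot_natCast` (the
  rational classes `0 ≤ ω < q` are distinct).
* **(16.3)**: `ratioClass q z₁ z₂ = Re(z₁z̄₂)·(N z₂)⁻¹` (an integer representative of `z₁/z₂`,
  cf. (6.6)), `dvd_im_star_mul_of_dvd_sub`, `dvd_sub_ratioClass_mul_of_dvd_im`,
  `dvd_sub_ratioClass_of_dvd_sub` (uniqueness of the rational class), `dvd_im_star_mul_iff_exists`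
  (`q ∣ Δ(z₁,z₂) ↔ ∃ ω ∈ ℤ, z₁ ≡ ω z₂ (mod q)`, for `(N z₂, q) = 1`), `isCoprime_ratioClass`;
  `sum_range_indicator_dvd_sub_eq` (`∑_{0≤ω<q} [z₁ ≡ ωz₂] F(ω) = [q ∣ Δ] F(ω(z₁,z₂))`: (16.2) ⇒
  (16.4), (17.1) ⇒ (17.9)).
* **(16.11)/(17.10)**: `sum_sum_dvd_im_eq_sum_mulChar` (bilinear form) and
  `sum_sum_dvd_im_conj_eq_sum_mulChar` (hermitian form
  `∑∑_{q∣Δ} F(ω(z₁,z₂)) conj(c z₁) c z₂ = Φ⁻¹ ∑_χ 𝒥_F(χ) |∑_z c(z)χ(z)|²`), with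
  `𝒥_F(χ) = ∑_{0≤ω<q} F(ω)χ(ω)` ((16.13), (17.11); `charSum_range_eq_filter`: only `(ω, q) = 1`
  contribute); **(16.42)** `sum_norm_sq_charSum_range_eq`
  (`Φ⁻¹ ∑_χ |𝒥_F(χ)|² = ∑_{(ω,q)=1} |F(ω)|²`, `= φ(q)` for `|F| = 1`).

Conventions. `Δ(z₁, z₂) = (star z₁ * z₂).im = r₁s₂ − r₂s₁` ((6.1), (6.5); the tree's `det2` on
pairs, `…Lemma51`). The class `ω(z₁, z₂)` represents `z₁/z₂`; FI write the symbol at `z₂/z₁`, the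
inverse class, on which a real character takes the same value. The printed (16.11) carries
`β_{z₁} β̄_{z₂}` and `𝒥(χ)`; the hermitian form here carries `conj(c z₁) c z₂`, i.e. it is the
complex conjugate of the printed arrangement with `χ ↦ χ̄` — the same real number in the
application (`F` real, `𝒥` real).

## References

* J. Friedlander, H. Iwaniec, Ann. of Math. (2) 148 (1998), 945–1040, §16 (16.3)–(16.4),
  (16.11)–(16.13), (16.42); §17 (17.9)–(17.11). [FriedlanderIwaniecAnnals1998]

## Mathlib / tree search

Mathlib: `MulChar.exists_apply_ne_one_of_hasEnoughRootsOfUnity`,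
`MulChar.card_eq_card_units_of_hasEnoughRootsOfUnity`, `IsSepClosed.hasEnoughRootsOfUnity`,
`Monoid.exponent_ne_zero_of_finite`, `Ideal.Quotient.eq`, `Ideal.mem_span_singleton`,
`Zsqrtd.intCast_dvd`, `Zsqrtd.norm_eq_mul_conj`, `Int.gcd_eq_gcd_ab`, `Complex.conj_mul'`,
`Finset.sum_mul_sum`, `Finset.sum_comm`. Tree (same pattern, other rings):
`CubicSieve.sum_mulChar_apply_eq`, `CubicSieve.sum_mulChar_inv_mul_eq` (`HeathBrownCubicLemma92Cube`).
-/

noncomputable section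

open Finset Complex

namespace Literature.NumberTheory.Sieve.FriedlanderIwaniecPrimes

/-! ### Characters of a finite commutative ring: orthogonality over the characters -/

section Orthogonality

variable {M : Type*} [CommRing M] [Fintype M] [DecidableEq M]

omit [DecidableEq M] in
/-- `ℂ` has enough roots of unity for the unit group of a finite commutative ring. [folklore] -/
theorem hasEnoughRootsOfUnity_units : HasEnoughRootsOfUnity ℂ (Monoid.exponent Mˣ) := by
  haveI : NeZero ((Monoid.exponent Mˣ : ℕ) : ℂ) :=
    ⟨Nat.cast_ne_zero.mpr Monoid.exponent_ne_zero_of_finite⟩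
  infer_instance

/-- The characters of a finite commutative ring with values in `ℂ` form a finite group. [folklore] -/
instance fintypeMulChar : Fintype (MulChar M ℂ) := Fintype.ofFinite _

/-- The number of characters equals the number of units. [folklore] -/
theorem card_mulChar_eq_card_units : Fintype.card (MulChar M ℂ) = Fintype.card Mˣ := by
  haveI := hasEnoughRootsOfUnity_units (M := M)
  rw [← Nat.card_eq_fintype_card, ← Nat.card_eq_fintype_card]
  exact MulChar.card_eq_card_units_of_hasEnoughRootsOfUnity M ℂ

omit [DecidableEq M] in
/-- The number of characters is positive. [folklore] -/
theorem card_mulChar_pos : 0 < Fintype.card (MulChar M ℂ) := Fintype.card_pos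

/-- A character value at a unit has norm one. [folklore] -/
theorem norm_mulChar_apply_units (χ : MulChar M ℂ) (u : Mˣ) : ‖χ (u : M)‖ = 1 := by
  have h : χ (u : M) ^ Fintype.card Mˣ = 1 := by
    rw [← map_pow, ← Units.val_pow_eq_pow_val, pow_card_eq_one, Units.val_one, map_one]
  exact Complex.norm_eq_one_of_pow_eq_one h Fintype.card_ne_zero

/-- A character value at a unit, inverted, is its conjugate. [folklore] -/
theorem inv_mulChar_apply_units (χ : MulChar M ℂ) (u : Mˣ) :
    (χ (u : M))⁻¹ = starRingEnd ℂ (χ (u : M)) := by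
  rw [Complex.inv_def, normSq_eq_norm_sq, norm_mulChar_apply_units]
  simp

omit [Fintype M] [DecidableEq M] in
/-- `χ⁻¹(u) = χ(u)⁻¹` at a unit. [folklore] -/
theorem mulChar_inv_apply_units (χ : MulChar M ℂ) (u : Mˣ) :
    χ⁻¹ (u : M) = (χ (u : M))⁻¹ := by
  rw [MulChar.inv_apply_eq_inv, Ring.inverse_eq_inv']

/-- A character vanishes off the units and has norm `≤ 1` everywhere. [folklore] -/
theorem norm_mulChar_apply_le_one (χ : MulChar M ℂ) (a : M) : ‖χ a‖ ≤ 1 := by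
  by_cases ha : IsUnit a
  · obtain ⟨u, rfl⟩ := ha
    rw [norm_mulChar_apply_units]
  · rw [χ.map_nonunit ha, norm_zero]; exact zero_le_one

/-- **Orthogonality over the characters, first form**: `∑_χ χ(b) = #Mˣ · [b = 1]`. [folklore] -/
theorem sum_mulChar_apply (b : M) :
    ∑ χ : MulChar M ℂ, χ b = if b = 1 then (Fintype.card Mˣ : ℂ) else 0 := by
  haveI := hasEnoughRootsOfUnity_units (M := M)
  split_ifs with hb
  · rw [hb]
    simp only [map_one, sum_const, card_univ, nsmul_eq_mul, mul_one, card_mulChar_eq_card_units]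
  · obtain ⟨χ, hχ⟩ := MulChar.exists_apply_ne_one_of_hasEnoughRootsOfUnity M ℂ hb
    refine eq_zero_of_mul_eq_self_left hχ ?_
    simp only [mul_sum, ← MulChar.mul_apply]
    exact Fintype.sum_bijective _ (Group.mulLeft_bijective χ) _ _ fun χ' => rfl

/-- **Orthogonality over the characters, second form**: for `a` a unit,
`∑_χ χ(a)⁻¹ χ(b) = #Mˣ · [a = b]`. [folklore] -/
theorem sum_mulChar_inv_mul_apply {a : M} (ha : IsUnit a) (b : M) :
    ∑ χ : MulChar M ℂ, (χ a)⁻¹ * χ b = if a = b then (Fintype.card Mˣ : ℂ) else 0 := by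
  obtain ⟨u, rfl⟩ := ha
  have hinv : ∀ χ : MulChar M ℂ, (χ (u : M))⁻¹ = χ ((u⁻¹ : Mˣ) : M) := by
    intro χ
    have h1 : χ ((u⁻¹ : Mˣ) : M) * χ (u : M) = 1 := by
      rw [← map_mul, Units.inv_mul, map_one]
    exact inv_eq_of_mul_eq_one_left h1
  simp_rw [hinv, ← map_mul]
  rw [sum_mulChar_apply]
  have hiff : ((u⁻¹ : Mˣ) : M) * b = 1 ↔ (u : M) = b := by
    rw [Units.inv_mul_eq_one, eq_comm]
  by_cases h : (u : M) = b
  · rw [if_pos (hiff.mpr h), if_pos h]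
  · rw [if_neg (fun h' => h (hiff.mp h')), if_neg h]

/-- **Detecting `x = ω y` by characters**: for units `x`, `y`, `ω`,
`[x = ω y] = #Mˣ⁻¹ ∑_χ χ(ω) χ(y) χ(x)⁻¹`. [cite: FriedlanderIwaniecAnnals1998, §16 before (16.11)] -/
theorem indicator_eq_sum_mulChar {x : M} (hx : IsUnit x) (ω y : M) :
    (if x = ω * y then (1 : ℂ) else 0) =
      (Fintype.card Mˣ : ℂ)⁻¹ * ∑ χ : MulChar M ℂ, (χ x)⁻¹ * (χ ω * χ y) := by
  simp_rw [← map_mul]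
  rw [sum_mulChar_inv_mul_apply hx]
  have hc : (Fintype.card Mˣ : ℂ) ≠ 0 := Nat.cast_ne_zero.mpr Fintype.card_ne_zero
  split_ifs
  · exact (inv_mul_cancel₀ hc).symm
  · simp

/-- **The detection identity behind (16.11) and (17.10)**, bilinear form: for a finite family of
points `g a ∈ Mˣ` (`a ∈ S`), a finite family of multipliers `e i ∈ M` with weights `j i` (`i ∈ H`),
and coefficients `c₁, c₂`,
`∑_{i ∈ H} j(i) ∑∑_{a, b ∈ S, g a = e i · g b} c₁(a) c₂(b)
  = #Mˣ⁻¹ ∑_χ (∑_{i∈H} j(i) χ(e i)) (∑_{a∈S} c₁(a) χ(g a)⁻¹) (∑_{b∈S} c₂(b) χ(g b))`.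
[cite: FriedlanderIwaniecAnnals1998, (16.11), (17.10)] -/
theorem sum_indicator_mul_eq_sum_mulChar {α ι : Type*} (S : Finset α) (g : α → M)
    (hg : ∀ a ∈ S, IsUnit (g a)) (H : Finset ι) (e : ι → M) (j : ι → ℂ) (c₁ c₂ : α → ℂ) :
    ∑ i ∈ H, j i * ∑ a ∈ S, ∑ b ∈ S, (if g a = e i * g b then c₁ a * c₂ b else 0) =
      (Fintype.card Mˣ : ℂ)⁻¹ * ∑ χ : MulChar M ℂ,
        (∑ i ∈ H, j i * χ (e i)) * ((∑ a ∈ S, c₁ a * (χ (g a))⁻¹) * ∑ b ∈ S, c₂ b * χ (g b)) := by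
  set κ : ℂ := (Fintype.card Mˣ : ℂ)⁻¹ with hκ
  -- both sides equal the quadruple sum of `T i a b χ`
  set T : ι → α → α → MulChar M ℂ → ℂ :=
    fun i a b χ => κ * (j i * χ (e i) * (c₁ a * (χ (g a))⁻¹) * (c₂ b * χ (g b))) with hT
  have hpt : ∀ i ∈ H, ∀ a ∈ S, ∀ b ∈ S,
      j i * (if g a = e i * g b then c₁ a * c₂ b else 0) = ∑ χ : MulChar M ℂ, T i a b χ := by
    intro i _ a ha b _
    have h1 : (if g a = e i * g b then c₁ a * c₂ b else 0) =
        c₁ a * c₂ b * (if g a = e i * g b then (1 : ℂ) else 0) := by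
      split_ifs <;> simp
    rw [h1, indicator_eq_sum_mulChar (hg a ha) (e i) (g b)]
    simp only [hT, mul_sum]
    exact sum_congr rfl fun χ _ => by ring
  have lhs : ∑ i ∈ H, j i * ∑ a ∈ S, ∑ b ∈ S, (if g a = e i * g b then c₁ a * c₂ b else 0) =
      ∑ i ∈ H, ∑ a ∈ S, ∑ b ∈ S, ∑ χ : MulChar M ℂ, T i a b χ := by
    refine sum_congr rfl fun i hi => ?_
    rw [mul_sum]
    refine sum_congr rfl fun a ha => ?_
    rw [mul_sum]
    exact sum_congr rfl fun b hb => hpt i hi a ha b hb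
  have rhs : κ * ∑ χ : MulChar M ℂ,
      (∑ i ∈ H, j i * χ (e i)) * ((∑ a ∈ S, c₁ a * (χ (g a))⁻¹) * ∑ b ∈ S, c₂ b * χ (g b)) =
      ∑ χ : MulChar M ℂ, ∑ i ∈ H, ∑ a ∈ S, ∑ b ∈ S, T i a b χ := by
    rw [Finset.mul_sum]
    refine sum_congr rfl fun χ _ => ?_
    have e1 : (∑ a ∈ S, c₁ a * (χ (g a))⁻¹) * ∑ b ∈ S, c₂ b * χ (g b) =
        ∑ a ∈ S, ∑ b ∈ S, c₁ a * (χ (g a))⁻¹ * (c₂ b * χ (g b)) :=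
      Finset.sum_mul_sum S S (fun a => c₁ a * (χ (g a))⁻¹) (fun b => c₂ b * χ (g b))
    have e2 : (∑ i ∈ H, j i * χ (e i)) * ∑ a ∈ S, ∑ b ∈ S, c₁ a * (χ (g a))⁻¹ * (c₂ b * χ (g b)) =
        ∑ i ∈ H, ∑ a ∈ S, j i * χ (e i) * ∑ b ∈ S, c₁ a * (χ (g a))⁻¹ * (c₂ b * χ (g b)) :=
      Finset.sum_mul_sum H S (fun i => j i * χ (e i))
        (fun a => ∑ b ∈ S, c₁ a * (χ (g a))⁻¹ * (c₂ b * χ (g b)))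
    rw [e1, e2, Finset.mul_sum]
    refine sum_congr rfl fun i _ => ?_
    rw [Finset.mul_sum]
    refine sum_congr rfl fun a _ => ?_
    rw [Finset.mul_sum, Finset.mul_sum]
    exact sum_congr rfl fun b _ => by simp only [hT]; ring
  rw [lhs, rhs]
  symm
  rw [Finset.sum_comm (s := (univ : Finset (MulChar M ℂ))) (t := H)]
  refine sum_congr rfl fun i _ => ?_
  rw [Finset.sum_comm (s := (univ : Finset (MulChar M ℂ))) (t := S)]
  refine sum_congr rfl fun a _ => ?_
  exact Finset.sum_comm

/-- **Parseval for the partial character sums `𝒥(χ) = ∑_{i ∈ H} j(i) χ(e i)` ((16.13), (17.11))**: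
`#Mˣ⁻¹ ∑_χ ‖𝒥(χ)‖² = ∑_{i ∈ H} ‖j(i)‖²` when the `e i` (`i ∈ H`) are distinct units — FI (16.42)
(there `‖j‖ = 1` on `H`, the rational classes modulo `4d`, so the right side is `#H = φ(4d)`).
[cite: FriedlanderIwaniecAnnals1998, (16.42)] -/
theorem sum_norm_sq_charSum_eq {ι : Type*} (H : Finset ι) (e : ι → M) (hH : ∀ i ∈ H, IsUnit (e i))
    (he : Set.InjOn e H) (j : ι → ℂ) :
    (Fintype.card Mˣ : ℝ)⁻¹ * ∑ χ : MulChar M ℂ, ‖∑ i ∈ H, j i * χ (e i)‖ ^ 2 =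
      ∑ i ∈ H, ‖j i‖ ^ 2 := by
  -- work in `ℂ`: ‖w‖² = conj w * w
  have key : ((Fintype.card Mˣ : ℂ))⁻¹ * ∑ χ : MulChar M ℂ,
      (starRingEnd ℂ (∑ i ∈ H, j i * χ (e i)) * ∑ i ∈ H, j i * χ (e i)) =
        ∑ i ∈ H, starRingEnd ℂ (j i) * j i := by
    have hconj : ∀ χ : MulChar M ℂ, starRingEnd ℂ (∑ i ∈ H, j i * χ (e i)) =
        ∑ i ∈ H, starRingEnd ℂ (j i) * (χ (e i))⁻¹ := by
      intro χ
      rw [map_sum]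
      refine sum_congr rfl fun i hi => ?_
      obtain ⟨u, hu⟩ := hH i hi
      rw [map_mul, ← hu, inv_mulChar_apply_units]
    simp_rw [hconj]
    have h0 := sum_indicator_mul_eq_sum_mulChar (M := M) H e hH ({1} : Finset M) id
      (fun _ => (1 : ℂ)) (fun i => starRingEnd ℂ (j i)) j
    simp only [id, sum_singleton, map_one, one_mul] at h0
    rw [← h0]
    classical
    refine sum_congr rfl fun a ha => ?_
    have : ∀ b ∈ H, (if e a = e b then starRingEnd ℂ (j a) * j b else 0) =
        if a = b then starRingEnd ℂ (j a) * j b else 0 := by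
      intro b hb
      by_cases hab : a = b
      · rw [if_pos hab, if_pos (hab ▸ rfl)]
      · rw [if_neg hab, if_neg (fun h => hab (he ha hb h))]
    rw [sum_congr rfl this, sum_ite_eq, if_pos ha]
  apply Complex.ofReal_injective
  push_cast
  simp_rw [← Complex.conj_mul']
  exact key

end Orthogonality


/-! ### The residue ring `ℤ[i]/qℤ[i]` -/

section GaussQuot

/-- The residue ring `ℤ[i]/qℤ[i]`. [cite: FriedlanderIwaniecAnnals1998, §16 (16.3), (16.11)] -/
abbrev GaussQuot (q : ℕ) : Type := GaussianInt ⧸ Ideal.span {((q : ℕ) : GaussianInt)}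

/-- The reduction map `ℤ[i] → ℤ[i]/qℤ[i]`. [folklore] -/
abbrev toQuot (q : ℕ) : GaussianInt →+* GaussQuot q := Ideal.Quotient.mk _

variable {q : ℕ}

/-- `z ≡ w (mod q)` in `ℤ[i]/q` iff `q ∣ z - w` in `ℤ[i]`. [folklore] -/
theorem toQuot_eq_toQuot_iff (z w : GaussianInt) :
    toQuot q z = toQuot q w ↔ (q : GaussianInt) ∣ z - w := by
  rw [Ideal.Quotient.eq, Ideal.mem_span_singleton]

/-- A rational integer `q` divides `z = a + bi` in `ℤ[i]` iff `q ∣ a` and `q ∣ b`. [folklore] -/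
theorem natCast_dvd_iff (q : ℕ) (z : GaussianInt) :
    (q : GaussianInt) ∣ z ↔ (q : ℤ) ∣ z.re ∧ (q : ℤ) ∣ z.im := by
  have h := Zsqrtd.intCast_dvd (d := -1) (q : ℤ) z
  rwa [Int.cast_natCast] at h

/-- `q ∣ n` in `ℤ[i]` iff `q ∣ n` in `ℤ`, for a rational integer `n`. [folklore] -/
theorem natCast_dvd_intCast_iff (q : ℕ) (n : ℤ) :
    (q : GaussianInt) ∣ (n : GaussianInt) ↔ (q : ℤ) ∣ n := by
  rw [natCast_dvd_iff]
  simp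

/-- `z₁ ≡ ω z₂ (mod q)` in coordinates: `q ∣ r₁ - ω r₂` and `q ∣ s₁ - ω s₂`. [folklore] -/
theorem natCast_dvd_sub_intCast_mul_iff (q : ℕ) (z₁ z₂ : GaussianInt) (ω : ℤ) :
    (q : GaussianInt) ∣ z₁ - (ω : GaussianInt) * z₂ ↔
      (q : ℤ) ∣ z₁.re - ω * z₂.re ∧ (q : ℤ) ∣ z₁.im - ω * z₂.im := by
  rw [natCast_dvd_iff]
  simp

/-- Every class of `ℤ[i]/qℤ[i]` (`q ≥ 1`) has a representative `a + bi` with `0 ≤ a, b < q`.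
[folklore] -/
theorem exists_fin_toQuot_eq (hq : 0 < q) (x : GaussQuot q) :
    ∃ p : Fin q × Fin q, toQuot q ⟨(p.1 : ℤ), (p.2 : ℤ)⟩ = x := by
  obtain ⟨z, rfl⟩ := Ideal.Quotient.mk_surjective x
  have hq' : (0 : ℤ) < q := by exact_mod_cast hq
  have hre0 : 0 ≤ z.re % q := Int.emod_nonneg _ hq'.ne'
  have him0 : 0 ≤ z.im % q := Int.emod_nonneg _ hq'.ne'
  have hre1 : z.re % q < q := Int.emod_lt_of_pos _ hq'
  have him1 : z.im % q < q := Int.emod_lt_of_pos _ hq'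
  refine ⟨(⟨(z.re % q).toNat, by omega⟩, ⟨(z.im % q).toNat, by omega⟩), ?_⟩
  show toQuot q ⟨((z.re % q).toNat : ℤ), ((z.im % q).toNat : ℤ)⟩ = toQuot q z
  rw [Int.toNat_of_nonneg hre0, Int.toNat_of_nonneg him0, toQuot_eq_toQuot_iff, natCast_dvd_iff]
  refine ⟨?_, ?_⟩
  · show (q : ℤ) ∣ z.re % q - z.re
    rw [Int.emod_def]
    exact ⟨-(z.re / q), by ring⟩
  · show (q : ℤ) ∣ z.im % q - z.im
    rw [Int.emod_def]
    exact ⟨-(z.im / q), by ring⟩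

/-- `ℤ[i]/qℤ[i]` is finite for `q ≠ 0`. [folklore] -/
instance finite_gaussQuot [NeZero q] : Finite (GaussQuot q) :=
  Finite.of_surjective (fun p : Fin q × Fin q => toQuot q ⟨(p.1 : ℤ), (p.2 : ℤ)⟩)
    fun x => exists_fin_toQuot_eq (Nat.pos_of_ne_zero (NeZero.ne q)) x

/-- `ℤ[i]/qℤ[i]` as a `Fintype` (noncomputably). [folklore] -/
instance fintype_gaussQuot [NeZero q] : Fintype (GaussQuot q) := Fintype.ofFinite _

/-- Decidable equality on `ℤ[i]/qℤ[i]` (classical). [folklore] -/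
instance decEq_gaussQuot : DecidableEq (GaussQuot q) := Classical.decEq _

/-- `N z = z z̄` in `ℤ[i]`. [folklore] -/
theorem intCast_norm_eq_mul_star (z : GaussianInt) : ((z.norm : ℤ) : GaussianInt) = z * star z :=
  Zsqrtd.norm_eq_mul_conj z

/-- **A Gaussian integer whose norm is prime to `q` is a unit modulo `q`** (`z · z̄ = N z` is
invertible modulo `q`). [cite: FriedlanderIwaniecAnnals1998, §16 (16.11)] -/
theorem isUnit_toQuot_of_coprime {z : GaussianInt} (h : Nat.Coprime z.norm.natAbs q) :
    IsUnit (toQuot q z) := by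
  have hcop : IsCoprime (z.norm : ℤ) (q : ℤ) := by
    rw [Int.isCoprime_iff_gcd_eq_one, Int.gcd_eq_natAbs]
    simpa using h
  obtain ⟨u, v, huv⟩ := hcop
  refine IsUnit.of_mul_eq_one (toQuot q ((u : GaussianInt) * star z)) ?_
  rw [← map_mul, ← (toQuot q).map_one, toQuot_eq_toQuot_iff]
  refine ⟨-(v : GaussianInt), ?_⟩
  have h1 : ((u * z.norm + v * q : ℤ) : GaussianInt) = 1 := by rw [huv]; simp
  have h2 : z * ((u : GaussianInt) * star z) = (u : GaussianInt) * ((z.norm : ℤ) : GaussianInt) := by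
    rw [intCast_norm_eq_mul_star]; ring
  rw [h2, ← h1]
  push_cast
  ring

/-- `N(ω) = ω²` for a rational integer `ω`. [folklore] -/
theorem natAbs_norm_natCast (ω : ℕ) : ((ω : GaussianInt)).norm.natAbs = ω * ω := by
  have : ((ω : GaussianInt)).norm = (ω : ℤ) * ω := by
    rw [Zsqrtd.norm_def]; simp
  rw [this, Int.natAbs_mul, Int.natAbs_natCast]

/-- A rational integer prime to `q` is a unit modulo `q` in `ℤ[i]`. [folklore] -/
theorem isUnit_toQuot_natCast_of_coprime {ω : ℕ} (h : Nat.Coprime ω q) :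
    IsUnit (toQuot q (ω : GaussianInt)) := by
  apply isUnit_toQuot_of_coprime
  rw [natAbs_norm_natCast]
  exact Nat.coprime_mul_iff_left.mpr ⟨h, h⟩

/-- The rational classes `ω (mod q)`, `0 ≤ ω < q`, are distinct in `ℤ[i]/qℤ[i]`. [folklore] -/
theorem injOn_toQuot_natCast (q : ℕ) :
    Set.InjOn (fun ω : ℕ => toQuot q (ω : GaussianInt)) (range q : Finset ℕ) := by
  intro a ha b hb hab
  simp only [coe_range, Set.mem_Iio] at ha hb
  have h : (q : GaussianInt) ∣ (a : GaussianInt) - (b : GaussianInt) :=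
    (toQuot_eq_toQuot_iff _ _).mp hab
  have h' : (q : ℤ) ∣ (a : ℤ) - (b : ℤ) := by
    rw [← natCast_dvd_intCast_iff]; push_cast; exact h
  exact (Nat.ModEq.eq_of_lt_of_lt (Nat.modEq_iff_dvd.mpr h') hb ha).symm

/-! ### (16.3): `Δ(z₁, z₂) ≡ 0 (mod q)` iff `z₁ ≡ ω z₂ (mod q)` for a rational `ω` -/

/-- The determinant `Δ(z₁, z₂) = Im z̄₁ z₂ = r₁ s₂ - r₂ s₁` of (6.1), (6.5) for `z_j = r_j + i s_j`
(the tree's `det2 (r₁, s₁) (r₂, s₂)` of `…Lemma51`). [cite: FriedlanderIwaniecAnnals1998, (6.1), (6.5)] -/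
theorem im_star_mul (z₁ z₂ : GaussianInt) : (star z₁ * z₂).im = z₁.re * z₂.im - z₂.re * z₁.im := by
  simp; ring

/-- `Re(z₁ z̄₂) = r₁ r₂ + s₁ s₂`. [cite: FriedlanderIwaniecAnnals1998, (6.6)] -/
theorem re_mul_star (z₁ z₂ : GaussianInt) : (z₁ * star z₂).re = z₁.re * z₂.re + z₁.im * z₂.im := by
  simp

/-- An inverse of `N z` modulo `q`: an integer `m` with `m · N z ≡ 1 (mod q)` when `(N z, q) = 1`
(Bézout's coefficient). [folklore] -/
def normInv (q : ℕ) (z : GaussianInt) : ℤ := Int.gcdA z.norm q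

/-- `q ∣ normInv q z · N z - 1` when `(N z, q) = 1`. [folklore] -/
theorem dvd_normInv_mul_norm_sub_one {z : GaussianInt} (h : Nat.Coprime z.norm.natAbs q) :
    (q : ℤ) ∣ normInv q z * z.norm - 1 := by
  have hg : z.norm.gcd (q : ℤ) = 1 := by
    rw [Int.gcd_eq_natAbs]; simpa using h
  have hb := Int.gcd_eq_gcd_ab z.norm q
  rw [hg] at hb
  refine ⟨-Int.gcdB z.norm q, ?_⟩
  rw [normInv]
  push_cast at hb
  linear_combination -hb

/-- **The rational ratio class** `ω(z₁, z₂) = Re(z₁ z̄₂) · (N z₂)⁻¹`, an integer: when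
`z₁ ≡ ω z₂ (mod q)` for some rational `ω` (and `(N z₂, q) = 1`), `ω ≡ ω(z₁, z₂) (mod q)`; it
represents `z₁/z₂` modulo `q` (FI write the real character at `z₂/z₁`, the inverse class, which
has the same value). [cite: FriedlanderIwaniecAnnals1998, (6.6), (16.3)] -/
def ratioClass (q : ℕ) (z₁ z₂ : GaussianInt) : ℤ := (z₁ * star z₂).re * normInv q z₂

/-- If `z₁ ≡ ω z₂ (mod q)` with `ω` rational then `q ∣ Δ(z₁, z₂)`.
[cite: FriedlanderIwaniecAnnals1998, (16.3)] -/
theorem dvd_im_star_mul_of_dvd_sub {z₁ z₂ : GaussianInt} {ω : ℤ}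
    (h : (q : GaussianInt) ∣ z₁ - (ω : GaussianInt) * z₂) : (q : ℤ) ∣ (star z₁ * z₂).im := by
  rw [natCast_dvd_sub_intCast_mul_iff] at h
  obtain ⟨⟨a, ha⟩, ⟨b, hb⟩⟩ := h
  rw [im_star_mul]
  exact ⟨a * z₂.im - z₂.re * b, by linear_combination z₂.im * ha - z₂.re * hb⟩

/-- If `z₁ ≡ ω z₂ (mod q)` with `ω` rational and `(N z₂, q) = 1` then `ω ≡ ω(z₁, z₂) (mod q)`:
the rational class is unique. [cite: FriedlanderIwaniecAnnals1998, (16.3)] -/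
theorem dvd_sub_ratioClass_of_dvd_sub {z₁ z₂ : GaussianInt} {ω : ℤ}
    (h₂ : Nat.Coprime z₂.norm.natAbs q) (h : (q : GaussianInt) ∣ z₁ - (ω : GaussianInt) * z₂) :
    (q : ℤ) ∣ ω - ratioClass q z₁ z₂ := by
  rw [natCast_dvd_sub_intCast_mul_iff] at h
  obtain ⟨⟨a, ha⟩, ⟨b, hb⟩⟩ := h
  obtain ⟨c, hc⟩ := dvd_normInv_mul_norm_sub_one h₂
  rw [Zsqrtd.norm_def] at hc
  rw [ratioClass, re_mul_star]
  refine ⟨-(a * z₂.re + b * z₂.im) * normInv q z₂ - ω * c, ?_⟩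
  linear_combination (-(z₂.re * normInv q z₂)) * ha - (z₂.im * normInv q z₂) * hb - ω * hc

/-- If `q ∣ Δ(z₁, z₂)` and `(N z₂, q) = 1` then `z₁ ≡ ω(z₁, z₂) z₂ (mod q)`.
[cite: FriedlanderIwaniecAnnals1998, (16.3)] -/
theorem dvd_sub_ratioClass_mul_of_dvd_im {z₁ z₂ : GaussianInt} (h₂ : Nat.Coprime z₂.norm.natAbs q)
    (h : (q : ℤ) ∣ (star z₁ * z₂).im) :
    (q : GaussianInt) ∣ z₁ - (ratioClass q z₁ z₂ : GaussianInt) * z₂ := by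
  rw [natCast_dvd_sub_intCast_mul_iff]
  obtain ⟨c, hc⟩ := dvd_normInv_mul_norm_sub_one h₂
  rw [Zsqrtd.norm_def] at hc
  rw [im_star_mul] at h
  obtain ⟨t, ht⟩ := h
  rw [ratioClass, re_mul_star]
  refine ⟨⟨-(z₁.re * c) + normInv q z₂ * z₂.im * t, ?_⟩, ⟨-(z₁.im * c) - normInv q z₂ * z₂.re * t, ?_⟩⟩
  · linear_combination (-z₁.re) * hc + (normInv q z₂ * z₂.im) * ht
  · linear_combination (-z₁.im) * hc - (normInv q z₂ * z₂.re) * ht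

/-- **(16.3)**: for `(N z₂, q) = 1`, `Δ(z₁, z₂) ≡ 0 (mod q)` iff `z₁ ≡ ω z₂ (mod q)` for some
rational integer `ω`. [cite: FriedlanderIwaniecAnnals1998, (16.3)] -/
theorem dvd_im_star_mul_iff_exists {z₁ z₂ : GaussianInt} (h₂ : Nat.Coprime z₂.norm.natAbs q) :
    (q : ℤ) ∣ (star z₁ * z₂).im ↔ ∃ ω : ℤ, (q : GaussianInt) ∣ z₁ - (ω : GaussianInt) * z₂ :=
  ⟨fun h => ⟨_, dvd_sub_ratioClass_mul_of_dvd_im h₂ h⟩, fun ⟨_, h⟩ => dvd_im_star_mul_of_dvd_sub h⟩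

/-- If `q ∣ Δ(z₁, z₂)` and both norms are prime to `q`, the ratio class is prime to `q`.
[cite: FriedlanderIwaniecAnnals1998, (16.3)] -/
theorem isCoprime_ratioClass {z₁ z₂ : GaussianInt} (h₁ : Nat.Coprime z₁.norm.natAbs q)
    (h₂ : Nat.Coprime z₂.norm.natAbs q) (h : (q : ℤ) ∣ (star z₁ * z₂).im) :
    IsCoprime (ratioClass q z₁ z₂) (q : ℤ) := by
  -- `z₁ ≡ ω z₂` gives `N z₁ ≡ ω² N z₂`, so a common prime factor of `ω` and `q` divides `N z₁`
  have hd := dvd_sub_ratioClass_mul_of_dvd_im h₂ h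
  rw [natCast_dvd_sub_intCast_mul_iff] at hd
  obtain ⟨⟨a, ha⟩, ⟨b, hb⟩⟩ := hd
  set ω := ratioClass q z₁ z₂
  have hN : z₁.norm = ω ^ 2 * z₂.norm + q * (2 * ω * (z₂.re * a + z₂.im * b) + q * (a ^ 2 + b ^ 2)) := by
    rw [Zsqrtd.norm_def, Zsqrtd.norm_def]
    have e1 : z₁.re = ω * z₂.re + q * a := by linear_combination ha
    have e2 : z₁.im = ω * z₂.im + q * b := by linear_combination hb
    rw [e1, e2]; ring
  have hc1 : IsCoprime z₁.norm (q : ℤ) := by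
    rw [Int.isCoprime_iff_gcd_eq_one, Int.gcd_eq_natAbs]; simpa using h₁
  rw [hN] at hc1
  have hc2 : IsCoprime (ω ^ 2 * z₂.norm) (q : ℤ) := hc1.of_add_mul_left_left
  exact (IsCoprime.pow_left_iff two_pos).mp (IsCoprime.of_mul_left_left hc2)

/-- A rational integer NOT prime to `q` is not a unit modulo `q` in `ℤ[i]` (it is a zero divisor).
[folklore] -/
theorem not_isUnit_toQuot_natCast {ω : ℕ} (hq : 0 < q) (h : ¬ Nat.Coprime ω q) :
    ¬ IsUnit (toQuot q (ω : GaussianInt)) := by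
  intro hu
  set g := Nat.gcd ω q with hg
  have hg0 : 0 < g := Nat.gcd_pos_of_pos_right _ hq
  have hg1 : g ≠ 1 := h
  obtain ⟨k, hk⟩ : g ∣ q := Nat.gcd_dvd_right ω q
  obtain ⟨m, hm⟩ : g ∣ ω := Nat.gcd_dvd_left ω q
  have hk0 : 0 < k := Nat.pos_of_ne_zero (by rintro rfl; simp at hk; omega)
  -- `ω · k = q · m ≡ 0`, so `k ≡ 0 (mod q)` as `ω` is a unit; but `0 < k < q`.
  have h0 : toQuot q (ω : GaussianInt) * toQuot q (k : GaussianInt) = 0 := by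
    rw [← map_mul, Ideal.Quotient.eq_zero_iff_mem, Ideal.mem_span_singleton]
    refine ⟨(m : GaussianInt), ?_⟩
    have : ω * k = q * m := by
      rw [hm, hk]; ring
    exact_mod_cast this
  have hk' : toQuot q (k : GaussianInt) = 0 := by
    obtain ⟨u, hu⟩ := hu
    rw [← hu] at h0
    simpa using congrArg (fun x => (↑u⁻¹ : GaussQuot q) * x) h0
  rw [Ideal.Quotient.eq_zero_iff_mem, Ideal.mem_span_singleton] at hk'
  have hqk : (q : ℤ) ∣ (k : ℤ) := by
    have := (natCast_dvd_intCast_iff q (k : ℤ))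
    push_cast at this
    exact this.mp hk'
  have hle : q ≤ k := Nat.le_of_dvd hk0 (by exact_mod_cast hqk)
  have : g * k ≤ 1 * k := by rw [← hk, one_mul]; exact hle
  have hg2 : g ≤ 1 := Nat.le_of_mul_le_mul_right this hk0
  omega

/-! ### Summing over the rational classes -/

open scoped Classical in
/-- **Summing a `q`-periodic weight over the rational classes**: for `(N z₂, q) = 1` and a
`q`-periodic `F`, `∑_{0 ≤ ω < q} [z₁ ≡ ω z₂ (mod q)] F(ω) = [q ∣ Δ(z₁, z₂)] F(ω(z₁, z₂))` — the
step from (16.2) to (16.4) (and from (17.1) to (17.9)).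
[cite: FriedlanderIwaniecAnnals1998, (16.3)-(16.4), (17.9)] -/
theorem sum_range_indicator_dvd_sub_eq (hq : 0 < q) {z₁ z₂ : GaussianInt}
    (h₂ : Nat.Coprime z₂.norm.natAbs q) (F : ℤ → ℂ)
    (hF : ∀ ω ω' : ℤ, (q : ℤ) ∣ ω - ω' → F ω = F ω') :
    ∑ ω ∈ range q, (if (q : GaussianInt) ∣ z₁ - ((ω : ℤ) : GaussianInt) * z₂ then F ω else 0) =
      if (q : ℤ) ∣ (star z₁ * z₂).im then F (ratioClass q z₁ z₂) else 0 := by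
  have hq' : (0 : ℤ) < q := by exact_mod_cast hq
  by_cases hΔ : (q : ℤ) ∣ (star z₁ * z₂).im
  · rw [if_pos hΔ]
    set ρ := ratioClass q z₁ z₂ with hρ
    have h0 : 0 ≤ ρ % q := Int.emod_nonneg _ hq'.ne'
    have h1 : ρ % q < q := Int.emod_lt_of_pos _ hq'
    set n₀ : ℕ := (ρ % q).toNat with hn₀
    have hn₀Z : (n₀ : ℤ) = ρ % q := Int.toNat_of_nonneg h0
    have hn₀mem : n₀ ∈ range q := by rw [mem_range]; omega
    have hmod : (q : ℤ) ∣ (n₀ : ℤ) - ρ := by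
      rw [hn₀Z, Int.emod_def]; exact ⟨-(ρ / q), by ring⟩
    rw [sum_eq_single_of_mem n₀ hn₀mem]
    · have hdvd : (q : GaussianInt) ∣ z₁ - ((n₀ : ℤ) : GaussianInt) * z₂ := by
        have e : z₁ - ((n₀ : ℤ) : GaussianInt) * z₂ =
            (z₁ - (ρ : GaussianInt) * z₂) + ((ρ - n₀ : ℤ) : GaussianInt) * z₂ := by
          push_cast; ring
        rw [e]
        refine dvd_add (dvd_sub_ratioClass_mul_of_dvd_im h₂ hΔ) (Dvd.dvd.mul_right ?_ _)
        rw [natCast_dvd_intCast_iff, ← dvd_neg, neg_sub]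
        exact hmod
      rw [if_pos hdvd]
      exact hF _ _ hmod
    · intro ω hω hne
      rw [if_neg]
      intro hdvd
      have hu := dvd_sub_ratioClass_of_dvd_sub h₂ hdvd
      rw [mem_range] at hω
      apply hne
      have h3 : (q : ℤ) ∣ (n₀ : ℤ) - (ω : ℤ) := by
        have e : (n₀ : ℤ) - (ω : ℤ) = ((n₀ : ℤ) - ρ) - ((ω : ℤ) - ρ) := by ring
        rw [e]
        exact dvd_sub hmod hu
      have := Nat.ModEq.eq_of_lt_of_lt (Nat.modEq_iff_dvd.mpr h3) hω (by omega : n₀ < q)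
      exact this
  · rw [if_neg hΔ]
    refine sum_eq_zero fun ω _ => ?_
    rw [if_neg]
    exact fun h => hΔ (dvd_im_star_mul_of_dvd_sub h)

/-- `z₁ ≡ ω z₂ (mod q)` as an equation in `ℤ[i]/qℤ[i]`. [folklore] -/
theorem toQuot_eq_mul_iff (z₁ z₂ : GaussianInt) (ω : ℤ) :
    toQuot q z₁ = toQuot q (ω : GaussianInt) * toQuot q z₂ ↔
      (q : GaussianInt) ∣ z₁ - (ω : GaussianInt) * z₂ := by
  rw [← map_mul, toQuot_eq_toQuot_iff]

open scoped Classical in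
/-- **The detection identity of §16/§17 for Gaussian integers** (the core of (16.11) and (17.10)):
for a finite set `S` of Gaussian integers with norms prime to `q`, a `q`-periodic weight `F` on
the rational classes and coefficients `c₁, c₂`,
`∑∑_{z₁, z₂ ∈ S, q ∣ Δ(z₁,z₂)} F(ω(z₁,z₂)) c₁(z₁) c₂(z₂)
   = Φ(q)⁻¹ ∑_{χ mod q} 𝒥_F(χ) (∑_{z ∈ S} c₁(z) χ(z)⁻¹) (∑_{z ∈ S} c₂(z) χ(z))`,
`Φ(q) = #(ℤ[i]/qℤ[i])ˣ`, `𝒥_F(χ) = ∑_{0 ≤ ω < q} F(ω) χ(ω)` ((16.13), (17.11)).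
[cite: FriedlanderIwaniecAnnals1998, (16.11), (17.10)] -/
theorem sum_sum_dvd_im_eq_sum_mulChar [NeZero q] (S : Finset GaussianInt)
    (hS : ∀ z ∈ S, Nat.Coprime z.norm.natAbs q) (F : ℤ → ℂ)
    (hF : ∀ ω ω' : ℤ, (q : ℤ) ∣ ω - ω' → F ω = F ω') (c₁ c₂ : GaussianInt → ℂ) :
    ∑ z₁ ∈ S, ∑ z₂ ∈ S,
        (if (q : ℤ) ∣ (star z₁ * z₂).im then F (ratioClass q z₁ z₂) * (c₁ z₁ * c₂ z₂) else 0) =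
      (Fintype.card (GaussQuot q)ˣ : ℂ)⁻¹ * ∑ χ : MulChar (GaussQuot q) ℂ,
        (∑ ω ∈ range q, F ω * χ (toQuot q (ω : GaussianInt))) *
          ((∑ z ∈ S, c₁ z * (χ (toQuot q z))⁻¹) * ∑ z ∈ S, c₂ z * χ (toQuot q z)) := by
  have hq : 0 < q := Nat.pos_of_ne_zero (NeZero.ne q)
  -- Step 1: insert the sum over the rational classes
  have step1 : ∀ z₁ ∈ S, ∀ z₂ ∈ S,
      (if (q : ℤ) ∣ (star z₁ * z₂).im then F (ratioClass q z₁ z₂) * (c₁ z₁ * c₂ z₂) else 0) =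
        ∑ ω ∈ range q, (if toQuot q z₁ = toQuot q ((ω : ℤ) : GaussianInt) * toQuot q z₂
          then F ω * (c₁ z₁ * c₂ z₂) else 0) := by
    intro z₁ _ z₂ hz₂
    have h := sum_range_indicator_dvd_sub_eq hq (z₁ := z₁) (hS z₂ hz₂) F hF
    have e : (if (q : ℤ) ∣ (star z₁ * z₂).im then F (ratioClass q z₁ z₂) * (c₁ z₁ * c₂ z₂) else 0) =
        (if (q : ℤ) ∣ (star z₁ * z₂).im then F (ratioClass q z₁ z₂) else 0) * (c₁ z₁ * c₂ z₂) := by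
      split_ifs <;> simp
    rw [e, ← h, sum_mul]
    refine sum_congr rfl fun ω _ => ?_
    by_cases hc : (q : GaussianInt) ∣ z₁ - ((ω : ℤ) : GaussianInt) * z₂
    · rw [if_pos hc, if_pos ((toQuot_eq_mul_iff _ _ _).mpr hc)]
    · rw [if_neg hc, if_neg (fun h' => hc ((toQuot_eq_mul_iff _ _ _).mp h')), zero_mul]
  -- Step 2: exchange the sums
  have step2 : ∑ z₁ ∈ S, ∑ z₂ ∈ S,
      (if (q : ℤ) ∣ (star z₁ * z₂).im then F (ratioClass q z₁ z₂) * (c₁ z₁ * c₂ z₂) else 0) =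
      ∑ ω ∈ range q, F ω * ∑ z₁ ∈ S, ∑ z₂ ∈ S,
        (if toQuot q z₁ = toQuot q ((ω : ℤ) : GaussianInt) * toQuot q z₂
          then c₁ z₁ * c₂ z₂ else 0) := by
    rw [sum_congr rfl fun z₁ hz₁ => sum_congr rfl fun z₂ hz₂ => step1 z₁ hz₁ z₂ hz₂]
    rw [sum_comm]
    refine (sum_congr rfl fun z₂ _ => sum_comm).trans ?_
    rw [sum_comm]
    refine sum_congr rfl fun ω _ => ?_
    rw [mul_sum, sum_comm]
    refine sum_congr rfl fun z₁ _ => ?_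
    rw [mul_sum]
    refine sum_congr rfl fun z₂ _ => ?_
    split_ifs <;> simp
  rw [step2]
  -- Step 3: the characters
  have h3 := sum_indicator_mul_eq_sum_mulChar (M := GaussQuot q) S (toQuot q)
    (fun z hz => isUnit_toQuot_of_coprime (hS z hz)) (range q)
    (fun ω : ℕ => toQuot q ((ω : ℤ) : GaussianInt)) (fun ω => F ω) c₁ c₂
  simp only [Int.cast_natCast] at h3 ⊢
  exact h3

/-- In `𝒥_F(χ)` only the classes prime to `q` contribute (the others are zero divisors, where
`χ` vanishes). [cite: FriedlanderIwaniecAnnals1998, (16.13)] -/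
theorem charSum_range_eq_filter (hq : 0 < q) (F : ℤ → ℂ) (χ : MulChar (GaussQuot q) ℂ) :
    ∑ ω ∈ range q, F ω * χ (toQuot q (ω : GaussianInt)) =
      ∑ ω ∈ (range q).filter (fun ω => Nat.Coprime ω q), F ω * χ (toQuot q (ω : GaussianInt)) := by
  rw [sum_filter]
  refine sum_congr rfl fun ω _ => ?_
  split_ifs with h
  · rfl
  · rw [χ.map_nonunit (not_isUnit_toQuot_natCast hq h), mul_zero]

/-- **(16.42), Parseval for `𝒥_F`**: `Φ(q)⁻¹ ∑_χ ‖𝒥_F(χ)‖² = ∑_{0 ≤ ω < q, (ω, q) = 1} ‖F(ω)‖²`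
(`= φ(q)` when `‖F‖ = 1` on the classes prime to `q`, e.g. `F = (·/d)` with `q = 4d`).
[cite: FriedlanderIwaniecAnnals1998, (16.42)] -/
theorem sum_norm_sq_charSum_range_eq [NeZero q] (F : ℤ → ℂ) :
    (Fintype.card (GaussQuot q)ˣ : ℝ)⁻¹ *
        ∑ χ : MulChar (GaussQuot q) ℂ, ‖∑ ω ∈ range q, F ω * χ (toQuot q (ω : GaussianInt))‖ ^ 2 =
      ∑ ω ∈ (range q).filter (fun ω => Nat.Coprime ω q), ‖F ω‖ ^ 2 := by
  have hq : 0 < q := Nat.pos_of_ne_zero (NeZero.ne q)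
  simp_rw [charSum_range_eq_filter hq]
  refine sum_norm_sq_charSum_eq (M := GaussQuot q) _ (fun ω : ℕ => toQuot q (ω : GaussianInt))
    (fun ω hω => isUnit_toQuot_natCast_of_coprime (mem_filter.mp hω).2) ?_ (fun ω => F ω)
  exact (injOn_toQuot_natCast q).mono (coe_subset.mpr (filter_subset _ _))

/-- **Hermitian form of the detection identity** ((16.11) as printed, up to complex conjugation
and the reindexing `χ ↦ χ̄`): with `S_χ(c) = ∑_{z ∈ S} c(z) χ(z)`,
`∑∑_{z₁, z₂ ∈ S, q ∣ Δ(z₁,z₂)} F(ω(z₁,z₂)) conj(c(z₁)) c(z₂) = Φ(q)⁻¹ ∑_χ 𝒥_F(χ) ‖S_χ(c)‖²`.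
[cite: FriedlanderIwaniecAnnals1998, (16.11), (17.10)] -/
theorem sum_sum_dvd_im_conj_eq_sum_mulChar [NeZero q] (S : Finset GaussianInt)
    (hS : ∀ z ∈ S, Nat.Coprime z.norm.natAbs q) (F : ℤ → ℂ)
    (hF : ∀ ω ω' : ℤ, (q : ℤ) ∣ ω - ω' → F ω = F ω') (c : GaussianInt → ℂ) :
    ∑ z₁ ∈ S, ∑ z₂ ∈ S, (if (q : ℤ) ∣ (star z₁ * z₂).im
        then F (ratioClass q z₁ z₂) * (starRingEnd ℂ (c z₁) * c z₂) else 0) =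
      (Fintype.card (GaussQuot q)ˣ : ℂ)⁻¹ * ∑ χ : MulChar (GaussQuot q) ℂ,
        (∑ ω ∈ range q, F ω * χ (toQuot q (ω : GaussianInt))) *
          ((‖∑ z ∈ S, c z * χ (toQuot q z)‖ ^ 2 : ℝ) : ℂ) := by
  rw [sum_sum_dvd_im_eq_sum_mulChar S hS F hF (fun z => starRingEnd ℂ (c z)) c]
  congr 1
  refine sum_congr rfl fun χ _ => ?_
  congr 1
  have hconj : ∑ z ∈ S, starRingEnd ℂ (c z) * (χ (toQuot q z))⁻¹ =
      starRingEnd ℂ (∑ z ∈ S, c z * χ (toQuot q z)) := by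
    rw [map_sum]
    refine sum_congr rfl fun z hz => ?_
    obtain ⟨u, hu⟩ := isUnit_toQuot_of_coprime (hS z hz)
    rw [map_mul, ← hu, inv_mulChar_apply_units]
  rw [hconj, Complex.conj_mul', Complex.ofReal_pow]

end GaussQuot

end Literature.NumberTheory.Sieve.FriedlanderIwaniecPrimes
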